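import Mathlib
import HarnessLib
import Summits.HubbardSuperconductivity.HubbardSuperconductivity.Theorems.KLProgrammeKLRegimeEngineOverlapMeanFreePieceRows

/-!
# K3 ENGINE child (stmt-HubbardSuperconductivity-20437), stub (b) (ℓ)/(I2), located item «(I2)-WT-WINDOW» (X1a): the OWN-RATE weighted `ℓ¹` character sum of
# ONE neighbouring-pair frame difference `F_{k+1}[K♯_{i+1}]·F_k[K♯_{i+1}] − F_{k+1}[K♯_i]·F_k[K♯_i]` along the mean-free chain —
# `≤ M·V²·(Φ₁·4^{k+1}/4^i + Φ₂)·G₀`, `G₀ = (c″+Gfr₁+Gfr₂+Gfr₃+1)U²`, `Φ₁, Φ₂` ABSOLUTE (W3 one level down: character sums, no row conversion)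

Cell `gate-hubbard-kl`, seat p4 g17 (taking «(I2)-WT-WINDOW» per I2-WT-WINDOW-DESIGN (k3c3-p2 g13) with k3c2-p3 g12's concurrence).  The window-free
general-jump overlap `E(F_{J′}[K_n])·S(F̃_k[K_n])` is assembled by p3's `overlapWt_jump_sums_le_of_nbWindow` from NEIGHBOURING thin × thin character sums at
every level `m ∈ [k+1, J′]` with the weight of rate `Λ_{J′} ≤ Λ_m`; so only each level's OWN-rate character sum
`Σ_z (1 + Λ_mβ/(2M)|z̃₁| + Λ_m|z̃₂| + Λ_m|z̃₃|)·‖S_{F_{m,ω}F_{m−1,a′}[K_n]}(z)‖` is needed WITHOUT p3's depth window, and that is a telescope along k3c3-p2's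
mean-free chain `K♯_i = K_i ⊖ symInterp (Σ_{Ico i n} mean)` (W1) with the registered-binder per-piece bound `charSumWt_thinPairDiff_meanFree'` (W2′).  This file
is the per-piece brick at the character-sum level: W3's `rowColSumWt_overlap_sub_meanFree` with p3's row conversion `rowSumWt_klReanalysis_sub_le_of_rates` replaced
by the POINTWISE weight domination `1 + Λβ/(2M)|z̃₁| + Λ(|z̃₂|+|z̃₃|) ≤ D_w·(1 + s₀|z̃₁| + (ρ/4^i)(|z̃₂|+|z̃₃|))`, `D_w = πΘ_c + Λ_{k+1}4^i/ρ` (W3's), and W3's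
`thinPair_rhs_majorant_sharp` reused verbatim:

* **`charSumWt_nbPair_sub_meanFree_ownRate`** — `∃ Φ₁ Φ₂ > 0` (absolute) such that along every admissible history in the KL regime with the (K5′) clauses
  (`∀ m, 1 ≤ m → m < n → FlowPieceOscAt … c″ … m`, `0 ≤ c″`, `c″U ≤ 1`), on every lattice `V` (`klEngL₃ ≤ V`), for `2(k+1)+5 ≤ i`, `i+1 ≤ n` and every sector
  pair: the own-rate weighted character sum of the piece is `≤ M·V²·((Φ₁·4^{k+1}/4^i + Φ₂)·G₀)`.

No definitions, no sorry.  Nothing asserts any stub, K3 or superconductivity. [cite: BenfattoGiulianiMastropietro2006, §2.7 (2.70)–(2.71a), §2.8 (2.77), §3 (3.2)–(3.8)]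
-/

noncomputable section

namespace Summit.HubbardSuperconductivity.HubbardSuperconductivity.Theorems.TorusFourierL2

set_option linter.dupNamespace false -- summit = problem name (single-conjunct summit), D-0017

open Set Finset Filter Topology Literature.MathematicalPhysics.QuantumLattice Literature.MathematicalPhysics.QuantumLattice.BandSectorCounting
open Literature.MathematicalPhysics.QuantumLattice.FermiRG Literature.Probability.LatticeModels Literature.Analysis.SpecialFunctions Literature.Analysis.Calculus
open Summit.HubbardSuperconductivity.HubbardSuperconductivity.Theorems.DispersionFlow
open Summit.HubbardSuperconductivity.HubbardSuperconductivity.Theorems.KLRegimeSplit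
open Summit.HubbardSuperconductivity.HubbardSuperconductivity.Theorems.KLProgrammeLegKernels
open Summit.HubbardSuperconductivity.HubbardSuperconductivity.Theorems.PerturbedFermiCurve
open Summit.HubbardSuperconductivity.HubbardSuperconductivity.Theorems.EngineV8
open Summit.HubbardSuperconductivity.HubbardSuperconductivity.Theorems.TwoVolumeSource
open scoped Real Nat

open Classical

set_option maxHeartbeats 4000000 in -- long statement (two chain frames) and one application of the per-piece bound
/-- **The own-rate weighted character sum of one neighbouring-pair frame difference along the mean-free chain** (see the module docstring).
[cite: BenfattoGiulianiMastropietro2006, §2.7 (2.70)–(2.71a), §2.8 (2.77), §3 (3.2)–(3.8)] -/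
theorem charSumWt_nbPair_sub_meanFree_ownRate :
    ∃ Φ₁ Φ₂ : ℝ, 0 < Φ₁ ∧ 0 < Φ₂ ∧
      ∀ (G : GeoConsts) (P : SplitConsts) (R : RenConsts) (Qe : EngConsts) (cc : ℝ), R.WF2 → 0 < cc → cc ≤ EngineV8.klEngC₃6 P R →
      ∀ μ ∈ klWindowC, ∀ U : ℝ, 0 < U → U ≤ min (EngineV8.klEngU₀3 P R cc) (1 / (R.Gfr 3 + 1)) → ∀ c'' : ℝ, 0 ≤ c'' → c'' * U ≤ 1 →
      ∀ β : ℝ, klBetaMin ≤ β → β ≤ Real.exp (cc / U ^ 2) →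
      ∀ (L M : ℕ) [NeZero L] [NeZero M], EngineV8.klEngL₃ β U ≤ L → EngineV8.klEngM₃ β U L ≤ M →
      ∀ n : ℕ, n ≤ nScales β + 1 → IsKLRegime U cc (-(n : ℤ)) → HistP klPredsV17F2 L M G P Qe R β U μ 0 n →
        (∀ m, 1 ≤ m → m < n → FlowPieceOscAt L M c'' β U μ m) →
        ∀ (V : ℕ) [NeZero V], EngineV8.klEngL₃ β U ≤ V →
        ∀ k i : ℕ, 2 * (k + 1) + 5 ≤ i → i + 1 ≤ n → ∀ (ω' : Fin (sectorCount (k + 1))) (a' : Fin (sectorCount k)),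
    ∑ zz : TorusSite 1 (2 * M) × TorusSite 2 V,
        (1 + klScale klE0 (k + 1) * β / (2 * M) * |(((zz.1 0).valMinAbs : ℤ) : ℝ)| + klScale klE0 (k + 1) * |(((zz.2 0).valMinAbs : ℤ) : ℝ)| +
            klScale klE0 (k + 1) * |(((zz.2 1).valMinAbs : ℤ) : ℝ)|) *
          ‖∑ q : TorusSite 1 (2 * M) × TorusSite 2 V, (torusChar q.1 zz.1 * torusChar q.2 zz.2) •
            (klAnisoFamily V M β μ (fsub (klFlowFrameU L M β U μ (i + 1)) (symInterp L fun _ => ∑ m ∈ Ico (i + 1) n, klAngularMean (klLocalPart L M β U μ (klFlowFrameU L M β U μ m) m))) klE0 (k + 1) ω' (⟨(q.1 0).val, ZMod.val_lt (q.1 0)⟩, q.2) *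
                klAnisoFamily V M β μ (fsub (klFlowFrameU L M β U μ (i + 1)) (symInterp L fun _ => ∑ m ∈ Ico (i + 1) n, klAngularMean (klLocalPart L M β U μ (klFlowFrameU L M β U μ m) m))) klE0 k a' (⟨(q.1 0).val, ZMod.val_lt (q.1 0)⟩, q.2) -
              klAnisoFamily V M β μ (fsub (klFlowFrameU L M β U μ i) (symInterp L fun _ => ∑ m ∈ Ico i n, klAngularMean (klLocalPart L M β U μ (klFlowFrameU L M β U μ m) m))) klE0 (k + 1) ω' (⟨(q.1 0).val, ZMod.val_lt (q.1 0)⟩, q.2) *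
                klAnisoFamily V M β μ (fsub (klFlowFrameU L M β U μ i) (symInterp L fun _ => ∑ m ∈ Ico i n, klAngularMean (klLocalPart L M β U μ (klFlowFrameU L M β U μ m) m))) klE0 k a' (⟨(q.1 0).val, ZMod.val_lt (q.1 0)⟩, q.2))‖ ≤
      M * (V : ℝ) ^ 2 * ((Φ₁ * (4 : ℝ) ^ (k + 1) / (4 : ℝ) ^ i + Φ₂) * ((c'' + R.Gfr 1 + R.Gfr 2 + R.Gfr 3 + 1) * U ^ 2)) := by
  have ha : (-4 : ℝ) < -(6 / 5) := by norm_num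
  have hab : (-(6 / 5) : ℝ) ≤ -(1 / 10) := by norm_num
  have hb : (-(1 / 10) : ℝ) < 0 := by norm_num
  obtain ⟨d, Ba, Q, Θc, A, hd0, -, hQ0, hΘc1, hA0, hADt, hρA, hflow⟩ := charSumWt_thinPairDiff_meanFree' ha hab hb
  set B : BandBounds (-(6 / 5)) (-(1 / 10)) := bandBounds ha hab hb with hBdef
  have hπ := Real.pi_pos
  have hπ3 := Real.pi_gt_three
  have hDtA : 0 < B.Dtmin - 2 * A := by linarith only [hADt]
  have hrho : 0 < 2 * B.rhomin - 4 * A := by linarith only [hρA]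
  have hsm := B.smax_pos
  have hDt0 := B.Dtmin_pos
  -- the absolute constants
  obtain ⟨rbar, hrbar⟩ : ∃ y : ℝ, y = (klE0 + B.smax * B.Dtmin * (3 * π / 4)) / (B.Dtmin - 2 * A) := ⟨_, rfl⟩
  obtain ⟨Wρ, hWρ⟩ : ∃ y : ℝ, y = (1 + 4 * Real.sqrt 2) ^ 2 * ((2 * Real.sqrt 2 / (1 / (4 * (Q + 1))) + 2) * (2 * Real.sqrt 2 / (1 / (4 * (Q + 1))) + 2)) +
      (1 / (1 / (4 * (Q + 1))) + 1) ^ 2 := ⟨_, rfl⟩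
  obtain ⟨K, hK⟩ : ∃ y : ℝ, y = 524288 * Wρ * (2 * π * Θc) * (96 * ((Real.sqrt 2 * ((1 + (4 + 4 * A) * rbar ^ 2) / (2 * B.rhomin - 4 * A)) / π + 2) *
      (2 * Real.sqrt 2 * rbar / π + 2))) := ⟨_, rfl⟩
  have hQ1 : 0 < Q + 1 := by linarith only [hQ0]
  have he : (0 : ℝ) < klE0 := by norm_num [klE0]
  have hWρ0 : 0 ≤ Wρ := by rw [hWρ]; positivity
  have hrbar0 : 0 ≤ rbar := by rw [hrbar]; exact div_nonneg (by positivity) hDtA.le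
  have hΘc0 : 0 < Θc := lt_of_lt_of_le one_pos hΘc1
  have hK0 : 0 ≤ K := by rw [hK]; positivity
  refine ⟨10 * d * klE0 ^ 2 * Real.sqrt K * (π * Θc * 32) + 1, 10 * d * klE0 ^ 2 * Real.sqrt K * (4 * (Q + 1)) + 1, by positivity, by positivity, ?_⟩
  intro G P R Qe cc hR2 hcc hcc6 μ hμ U hU hUle c'' hc0 hcU β hβmin hβc L M _ _ hL3 hM3 n hnN hreg hhist hosc V _ hV3 k i hki hin ω₁ a₁
  -- the per-piece bound along the chain, every pair
  have hT := fun (ω₁ : Fin (sectorCount (k + 1))) (a' : Fin (sectorCount k)) =>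
    hflow G P R Qe cc hR2 hcc hcc6 μ hμ U hU hUle c'' hc0 hcU β hβmin hβc L M hL3 hM3 n hnN hreg hhist hosc V hV3 k i hki hin ω₁ a'
  -- regime scalars
  have hRj : ∀ j, 0 ≤ R.Gfr j := EngineV8.gfr_nonneg_of_wf2 hR2
  have hcr : 0 ≤ R.cr := hR2.1.1
  have hβ0 : 0 < β := pos_of_klBetaMin_le hβmin
  have hβ2 : 2 ≤ β := le_trans (by norm_num [klBetaMin]) hβmin
  have hMβ : β ≤ (M : ℝ) := EngineV8.le_of_klEngM₃_le hβmin hL3 hM3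
  have hM0 : (0 : ℝ) < M := lt_of_lt_of_le hβ0 hMβ
  have hVβ : β ^ 2 ≤ (V : ℝ) := EngineV8.sq_le_of_klEngL₃_le hV3
  have hV1 : (1 : ℝ) ≤ V := le_trans (by nlinarith only [hβ2]) hVβ
  obtain ⟨hΛ0pos, hΛ1pos, -, hΛ1le1, -, -, -, -, hY01, -, -⟩ := thinPair_scale_facts k
  have hΛ01 : klScale klE0 (k + 1) ≤ klScale klE0 k := (one_div_le_one_div hΛ0pos hΛ1pos).mp hY01
  have hU3E : U ≤ EngineV8.klEngU₀3 P R cc := hUle.trans (min_le_left _ _)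
  have hU1 : U ≤ 1 := (hU3E.trans (EngineV8.klEngU₀3_le_symbolU₀ ha hab hb P hRj cc)).trans (min_le_left _ _)
  have hGU : ∀ {j : ℕ}, j < 5 → R.Gfr j * U ≤ 1 / (2 : ℝ) ^ 120 := fun hj => gfr_mul_le_of_le_klEngU₀3 P hU.le hU3E hj
  have hUd : U ≤ 1 / (2 ^ 12 * (R.Gfr 0 + R.Gfr 1 + R.cr + 1)) := hU3E.trans (klEngU₀3_le_inv_baseDoor P (hRj 0) (hRj 1) hcr cc)
  set G₀ : ℝ := (c'' + R.Gfr 1 + R.Gfr 2 + R.Gfr 3 + 1) * U ^ 2 with hG₀def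
  have hG₀0 : 0 ≤ G₀ := by rw [hG₀def]; have := hRj 1; have := hRj 2; have := hRj 3; positivity
  have hG₀2 : G₀ ≤ 2 := by
    rw [hG₀def]
    have h1 := hGU (j := 1) (by norm_num); have h2 := hGU (j := 2) (by norm_num); have h3 := hGU (j := 3) (by norm_num)
    have h120 : (1 : ℝ) / 2 ^ 120 ≤ 1 / 4 := by norm_num
    have hU12 : U ≤ 1 / 2 ^ 12 := hUd.trans (by
      refine one_div_le_one_div_of_le (by positivity) ?_
      nlinarith only [hRj 0, hRj 1, hcr])
    have hcU2 : c'' * U ^ 2 ≤ U := by nlinarith only [hcU, hU]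
    nlinarith only [h1, h2, h3, h120, hU1, hU, hU12, hcU2]
  obtain ⟨-, hx1, hGΛ, -⟩ := thinPair_depth_facts hki hG₀2
  have hx0 : (0 : ℝ) < (4 : ℝ) ^ i := by positivity
  have hRA0 : 0 ≤ (klScale klE0 (k + 1) + B.smax * B.Dtmin * (3 * sectorWidth k / 4)) / (B.Dtmin - 2 * A) := by
    have := sectorWidth_pos k; exact div_nonneg (by positivity) hDtA.le
  have hRA : (klScale klE0 (k + 1) + B.smax * B.Dtmin * (3 * sectorWidth k / 4)) / (B.Dtmin - 2 * A) ≤ rbar := by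
    rw [hrbar]; refine div_le_div_of_nonneg_right ?_ hDtA.le
    have h1 : klScale klE0 (k + 1) ≤ klE0 := klScale_le_e0 (by norm_num [klE0]) (k + 1)
    have h2 : sectorWidth k ≤ π := by
      show π / (2 : ℝ) ^ k ≤ π
      exact div_le_self hπ.le (one_le_pow₀ (by norm_num))
    nlinarith only [h1, h2, mul_pos hsm hDt0]
  -- `π ≤ Λ_{k+1}·β` (the thin scale is at most `nScales β`)
  have hπΛ : π ≤ klScale klE0 (k + 1) * β := by
    have h1 := klth_pi_div_le_klScale_nScales hβmin
    have h2 : klScale klE0 (nScales β) ≤ klScale klE0 (k + 1) := EngineV8.klScale_le_klScale he.le (by omega)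
    have := mul_le_mul_of_nonneg_right (h1.trans h2) hβ0.le
    rwa [div_mul_cancel₀ _ hβ0.ne'] at this
  -- the sharp closed-form majorant of the per-piece bound
  have hWρ0' : 0 ≤ (1 + 4 * Real.sqrt 2) ^ 2 * ((2 * Real.sqrt 2 / (1 / (4 * (Q + 1))) + 2) * (2 * Real.sqrt 2 / (1 / (4 * (Q + 1))) + 2)) +
      (1 / (1 / (4 * (Q + 1))) + 1) ^ 2 := by positivity
  have hmaj := thinPair_rhs_majorant_sharp (M := M) (V := V) (e₀ := klE0) hx1 hΛ1pos hΛ1le1 hΛ01 hβ2 hMβ hV1 rfl hΘc1 hWρ0' hA0 hrho hRA0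
    hRA hd0 hG₀0 hGΛ hπΛ
  have hTmaj := fun (ω₁ : Fin (sectorCount (k + 1))) (a' : Fin (sectorCount k)) => (hT ω₁ a').trans hmaj
  rw [← hWρ, ← hK] at hTmaj
  set T' : ℝ := M * (V : ℝ) ^ 2 * (10 * d * klE0 ^ 2 * Real.sqrt K * (1 / klScale klE0 (k + 1)) * G₀ / (4 : ℝ) ^ i) with hT'
  have hT'0 : 0 ≤ T' := by rw [hT']; positivity
  -- rates and domination: `D_w := πΘ_c + Λ_{k+1}·4^i/ρ`
  set ρ : ℝ := 1 / (4 * (Q + 1)) with hρdef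
  have hρpos : 0 < ρ := by rw [hρdef]; positivity
  set Dw : ℝ := π * Θc + klScale klE0 (k + 1) * (4 : ℝ) ^ i / ρ with hDwdef
  have hDw1 : 1 ≤ Dw := by
    rw [hDwdef]
    have h1 : (1 : ℝ) ≤ π * Θc := by nlinarith only [hπ3, hΘc1]
    have h2 : 0 ≤ klScale klE0 (k + 1) * (4 : ℝ) ^ i / ρ := by positivity
    linarith only [h1, h2]
  have hdom₀ : klScale klE0 (k + 1) * β / (2 * M) ≤ Dw * (klScale klE0 (k + 1) * β / (M * π * Θc)) := by
    have h2 : 0 ≤ klScale klE0 (k + 1) * (4 : ℝ) ^ i / ρ := by positivity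
    have hπΘ : π * Θc ≤ Dw := by rw [hDwdef]; linarith only [h2]
    have hs0 : 0 ≤ klScale klE0 (k + 1) * β / (M * π * Θc) := by positivity
    calc klScale klE0 (k + 1) * β / (2 * M) ≤ klScale klE0 (k + 1) * β / M :=
          div_le_div_of_nonneg_left (by positivity) hM0 (by linarith only [hM0])
      _ = (π * Θc) * (klScale klE0 (k + 1) * β / (M * π * Θc)) := by field_simp
      _ ≤ Dw * (klScale klE0 (k + 1) * β / (M * π * Θc)) := mul_le_mul_of_nonneg_right hπΘ hs0
  have hdom₁ : klScale klE0 (k + 1) ≤ Dw * (ρ / (4 : ℝ) ^ i) := by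
    have h1 : 0 ≤ π * Θc := by positivity
    have hge : klScale klE0 (k + 1) * (4 : ℝ) ^ i / ρ ≤ Dw := by rw [hDwdef]; linarith only [h1]
    calc klScale klE0 (k + 1) = (klScale klE0 (k + 1) * (4 : ℝ) ^ i / ρ) * (ρ / (4 : ℝ) ^ i) := by field_simp
      _ ≤ Dw * (ρ / (4 : ℝ) ^ i) := mul_le_mul_of_nonneg_right hge (by positivity)
  -- the pointwise weight domination and the assembly
  have hΛval : klScale klE0 (k + 1) = (1 / 32) * ((4 : ℝ) ^ (k + 1))⁻¹ := by rw [klScale, klE0]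
  have hwdom : ∀ zz : TorusSite 1 (2 * M) × TorusSite 2 V,
      (1 + klScale klE0 (k + 1) * β / (2 * M) * |(((zz.1 0).valMinAbs : ℤ) : ℝ)| + klScale klE0 (k + 1) * |(((zz.2 0).valMinAbs : ℤ) : ℝ)| +
          klScale klE0 (k + 1) * |(((zz.2 1).valMinAbs : ℤ) : ℝ)|) ≤
        Dw * (1 + (klScale klE0 (k + 1) * β / (M * π * Θc)) * |(((zz.1 0).valMinAbs : ℤ) : ℝ)| + ρ / (4 : ℝ) ^ i * |(((zz.2 0).valMinAbs : ℤ) : ℝ)| +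
          ρ / (4 : ℝ) ^ i * |(((zz.2 1).valMinAbs : ℤ) : ℝ)|) := by
    intro zz
    have h0 : 0 ≤ |(((zz.1 0).valMinAbs : ℤ) : ℝ)| := abs_nonneg _
    have h1 : 0 ≤ |(((zz.2 0).valMinAbs : ℤ) : ℝ)| := abs_nonneg _
    have h2 : 0 ≤ |(((zz.2 1).valMinAbs : ℤ) : ℝ)| := abs_nonneg _
    have t0 := mul_le_mul_of_nonneg_right hdom₀ h0
    have t1 := mul_le_mul_of_nonneg_right hdom₁ h1
    have t2 := mul_le_mul_of_nonneg_right hdom₁ h2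
    calc _ ≤ Dw * 1 + Dw * (klScale klE0 (k + 1) * β / (M * π * Θc)) * |(((zz.1 0).valMinAbs : ℤ) : ℝ)| +
          Dw * (ρ / (4 : ℝ) ^ i) * |(((zz.2 0).valMinAbs : ℤ) : ℝ)| + Dw * (ρ / (4 : ℝ) ^ i) * |(((zz.2 1).valMinAbs : ℤ) : ℝ)| := by
          linarith only [hDw1, t0, t1, t2]
      _ = _ := by ring
  have hsum := hTmaj ω₁ a₁
  have hfin : Dw * T' ≤ M * (V : ℝ) ^ 2 * (((10 * d * klE0 ^ 2 * Real.sqrt K * (π * Θc * 32) + 1) * (4 : ℝ) ^ (k + 1) / (4 : ℝ) ^ i +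
      (10 * d * klE0 ^ 2 * Real.sqrt K * (4 * (Q + 1)) + 1)) * G₀) := by
    have hV0 : (0 : ℝ) < V := lt_of_lt_of_le one_pos hV1
    have e : Dw * T' = M * (V : ℝ) ^ 2 * ((10 * d * klE0 ^ 2 * Real.sqrt K * (π * Θc * 32) * (4 : ℝ) ^ (k + 1) / (4 : ℝ) ^ i +
        10 * d * klE0 ^ 2 * Real.sqrt K * (4 * (Q + 1))) * G₀) := by
      rw [hT', hDwdef, hρdef, hΛval]; field_simp
    rw [e]
    have hMV : 0 ≤ (M : ℝ) * (V : ℝ) ^ 2 := by positivity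
    refine mul_le_mul_of_nonneg_left (mul_le_mul_of_nonneg_right ?_ hG₀0) hMV
    have h4 : 0 ≤ (4 : ℝ) ^ (k + 1) / (4 : ℝ) ^ i := by positivity
    have e1 : (10 * d * klE0 ^ 2 * Real.sqrt K * (π * Θc * 32) + 1) * (4 : ℝ) ^ (k + 1) / (4 : ℝ) ^ i =
        10 * d * klE0 ^ 2 * Real.sqrt K * (π * Θc * 32) * (4 : ℝ) ^ (k + 1) / (4 : ℝ) ^ i + (4 : ℝ) ^ (k + 1) / (4 : ℝ) ^ i := by ring
    rw [e1]; linarith only [h4]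
  refine le_trans ?_ ((mul_le_mul_of_nonneg_left hsum (zero_le_one.trans hDw1)).trans hfin)
  rw [Finset.mul_sum]
  refine Finset.sum_le_sum fun zz _ => ?_
  rw [← mul_assoc]
  exact mul_le_mul_of_nonneg_right (hwdom zz) (norm_nonneg _)

end Summit.HubbardSuperconductivity.HubbardSuperconductivity.Theorems.TorusFourierL2

end
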